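import Summits.AtomisticToContinuum.Crystallization.Theorems.FreeSplittingCertificatesStrictSplittingRuleLineTrussTrapezoid

/-!
# `StrictSplittingRule` (stmt-AtomisticToContinuum-12560): the telescoping majorant — a sharp second-order remainder for the line-truss tension

Route `FreeSplittingCertificates`, crux r3 `StrictSplittingRule`, line `registered` (unit b2b-freesplit-B, gen 14); sequel of
`…LineTrussTrapezoid.lean`.  The lattice-sum remainder of `h1_tail_asymp2` (`(K₂/12)(‖e‖³r⁻⁹ + (5π/32)‖e‖²r⁻⁸)`, `K₂ = 52`) decouples
the two extremal geometries (`⟪v+te,e⟫ ≤ ‖v+te‖‖e‖` is sharp for `v ∥ e`, the envelope `‖v+te‖² ≥ ‖v‖² + t²‖e‖²` for `v ⊥ e`) and is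
`≈ 8×` the true second-order term.  Keeping `p = ⟪v+te,e⟫ = ½ d/dt‖v+te‖²` inside the bound repairs this:

* `h1_line_load2_le_majorant` — `|F″(t)| ≤ (14 + 56‖v‖⁻⁶)‖e‖²·2p(‖v+te‖²)⁻⁵ = Ψ′(t)`, `Ψ(t) = −(C‖e‖²/4)(‖v+te‖²)⁻⁴`
  (`h1_line_hasDerivAt_majorant`), sharp in the direction `v ∥ e`;
* `h1_tail_step_sharp` — `|F(k+1) − (Φ(k+1) − Φ(k)) − ½(F(k+1) − F(k))| ≤ (1/8)(Ψ(k+1) − Ψ(k))`: `F′ ± Ψ` are monotone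
  (`monotoneOn_of_hasDerivWithinAt_nonneg`), so `|F′(s) − F′(k+½)| ≤ |Ψ(s) − Ψ(k+½)|`, and the centred integral
  `∫_k^{k+1}(s−k−½)(F′(s) − F′(k+½))ds` is split at `k+½` with `∫₀^{½} x dx = 1/8` on each side (`h1_integral_half`).

Summed over `k` the steps telescope to `(C‖e‖²/32)‖v‖⁻⁸` (next file, `h1_tail_asymp_sharp`): relative remainder `(21/4)(‖e‖/‖v‖)²`,
attained asymptotically for `v ∥ e` — no lattice sum, no `π`.  Structural bookkeeping ([folklore]); VALUE = a kernel-checked brick of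
the far lemma (HOME CERT.md §21) — NOT a proof of H12⋆, NOT summit progress.
-/

noncomputable section

namespace Summit.AtomisticToContinuum.Crystallization.Theorems.StrictSplittingRuleBirth

open scoped BigOperators Topology
open Filter Set
open Literature.MathematicalPhysics.StatisticalMechanics
open Summit.AtomisticToContinuum.Crystallization.Theorems.PalmUnimodularRigidity.LayeredLawsSelectHcp

/-! ## §5 The telescoping majorant: a sharp second-order remainder without lattice sums -/

section Line3

variable {v e : EuclideanSpace ℝ (Fin 3)}

/-- **Majorant form of the bound on `F″`** on an outgoing line (`v ≠ 0`, `⟪v,e⟫ ≥ 0`, `t ≥ 0`): with `σ = ‖v+te‖²`, `p = ⟪v+te,e⟫ ≥ 0`,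
`|F″(t)| ≤ (14 + 56‖v‖⁻⁶)‖e‖²·(2p·σ⁻⁵)` — and `2p σ⁻⁵ = −¼ d/dt(σ⁻⁴)` telescopes along the line.  (Sign structure: `2W‴p² ≤ 20σ⁻⁵‖e‖²`,
`2W‴p² ≥ −56σ₀⁻³σ⁻⁵‖e‖²`, `3W″‖e‖² ∈ [−6σ⁻⁵‖e‖², 10.5σ₀⁻³σ⁻⁵‖e‖²]`, `p² ≤ σ‖e‖²`; sharp in the direction `v ∥ e`.) [folklore] -/
theorem h1_line_load2_le_majorant (hv : 0 < ‖v‖) (hve : 0 ≤ inner ℝ v e) {t : ℝ} (ht : 0 ≤ t) :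
    |(10 * ((‖v + t • e‖ ^ 2)⁻¹) ^ 6 - 28 * ((‖v + t • e‖ ^ 2)⁻¹) ^ 9) * (4 * inner ℝ (v + t • e) e ^ 3) +
        (7 / 2 * ((‖v + t • e‖ ^ 2)⁻¹) ^ 8 - 2 * ((‖v + t • e‖ ^ 2)⁻¹) ^ 5) *
          (6 * inner ℝ (v + t • e) e * ‖e‖ ^ 2)| ≤
      (14 + 56 * (‖v‖⁻¹) ^ 6) * ‖e‖ ^ 2 * (2 * inner ℝ (v + t • e) e * ((‖v + t • e‖ ^ 2)⁻¹) ^ 5) := by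
  set σ := ‖v + t • e‖ ^ 2 with hσ
  set p := inner ℝ (v + t • e) e with hp
  set c := (‖v‖⁻¹) ^ 6 with hc
  have hσ₀ : ‖v‖ ^ 2 ≤ σ := le_trans (by nlinarith) (h1_line_norm_sq_ge hve ht).1
  have hv2 : 0 < ‖v‖ ^ 2 := by positivity
  have hσpos : 0 < σ := hv2.trans_le hσ₀
  have hp0 : 0 ≤ p := by rw [hp, h1_line_inner]; positivity
  have hpσ : p ^ 2 ≤ σ * ‖e‖ ^ 2 := by
    have h1 : |p| ≤ ‖v + t • e‖ * ‖e‖ := abs_real_inner_le_norm _ _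
    have h2 : p ^ 2 = |p| ^ 2 := (sq_abs p).symm
    rw [h2, hσ]
    calc |p| ^ 2 ≤ (‖v + t • e‖ * ‖e‖) ^ 2 := pow_le_pow_left₀ (abs_nonneg _) h1 2
      _ = ‖v + t • e‖ ^ 2 * ‖e‖ ^ 2 := by ring
  have hc' : ((‖v‖ ^ 2)⁻¹) ^ 3 = c := by rw [hc, inv_pow, inv_pow, ← pow_mul]
  have hi : σ⁻¹ ≤ (‖v‖ ^ 2)⁻¹ := (inv_le_inv₀ hσpos hv2).2 hσ₀
  have hi0 : 0 ≤ σ⁻¹ := inv_nonneg.2 hσpos.le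
  have hi3 : (σ⁻¹) ^ 3 ≤ c := by rw [← hc']; exact pow_le_pow_left₀ hi0 hi 3
  have hc0 : 0 ≤ c := by positivity
  -- `A = 2W‴p² + 3W″‖e‖²`, so that `F″ = 2p·A`
  set A : ℝ := 2 * (10 * (σ⁻¹) ^ 6 - 28 * (σ⁻¹) ^ 9) * p ^ 2 + 3 * (7 / 2 * (σ⁻¹) ^ 8 - 2 * (σ⁻¹) ^ 5) * ‖e‖ ^ 2 with hA
  have hFA : (10 * (σ⁻¹) ^ 6 - 28 * (σ⁻¹) ^ 9) * (4 * p ^ 3) + (7 / 2 * (σ⁻¹) ^ 8 - 2 * (σ⁻¹) ^ 5) * (6 * p * ‖e‖ ^ 2) =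
      2 * p * A := by rw [hA]; ring
  -- upper and lower bounds for `A`
  have hσi : σ * σ⁻¹ = 1 := mul_inv_cancel₀ hσpos.ne'
  have h5 : 0 ≤ (σ⁻¹) ^ 5 := by positivity
  have h6 : 0 ≤ (σ⁻¹) ^ 6 := by positivity
  have h8 : 0 ≤ (σ⁻¹) ^ 8 := by positivity
  have h9 : 0 ≤ (σ⁻¹) ^ 9 := by positivity
  have hup1 : (σ⁻¹) ^ 6 * p ^ 2 ≤ (σ⁻¹) ^ 5 * ‖e‖ ^ 2 := by
    calc (σ⁻¹) ^ 6 * p ^ 2 ≤ (σ⁻¹) ^ 6 * (σ * ‖e‖ ^ 2) := mul_le_mul_of_nonneg_left hpσ h6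
      _ = (σ⁻¹) ^ 5 * ‖e‖ ^ 2 * (σ * σ⁻¹) := by ring
      _ = (σ⁻¹) ^ 5 * ‖e‖ ^ 2 := by rw [hσi, mul_one]
  have hlow1 : (σ⁻¹) ^ 9 * p ^ 2 ≤ c * (σ⁻¹) ^ 5 * ‖e‖ ^ 2 := by
    calc (σ⁻¹) ^ 9 * p ^ 2 ≤ (σ⁻¹) ^ 9 * (σ * ‖e‖ ^ 2) := mul_le_mul_of_nonneg_left hpσ h9
      _ = (σ⁻¹) ^ 3 * (σ⁻¹) ^ 5 * ‖e‖ ^ 2 * (σ * σ⁻¹) := by ring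
      _ = (σ⁻¹) ^ 3 * ((σ⁻¹) ^ 5 * ‖e‖ ^ 2) := by rw [hσi, mul_one]; ring
      _ ≤ c * ((σ⁻¹) ^ 5 * ‖e‖ ^ 2) := mul_le_mul_of_nonneg_right hi3 (by positivity)
      _ = c * (σ⁻¹) ^ 5 * ‖e‖ ^ 2 := by ring
  have hup2 : (σ⁻¹) ^ 8 ≤ c * (σ⁻¹) ^ 5 := by
    calc (σ⁻¹) ^ 8 = (σ⁻¹) ^ 3 * (σ⁻¹) ^ 5 := by ring
      _ ≤ c * (σ⁻¹) ^ 5 := mul_le_mul_of_nonneg_right hi3 h5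
  have hAup : A ≤ (14 + 21 / 2 * c) * ((σ⁻¹) ^ 5 * ‖e‖ ^ 2) := by
    rw [hA]
    nlinarith [hup1, hup2, h9, mul_nonneg h9 (sq_nonneg p), sq_nonneg ‖e‖, mul_le_mul_of_nonneg_right hup2 (sq_nonneg ‖e‖)]
  have hAlow : -((6 + 56 * c) * ((σ⁻¹) ^ 5 * ‖e‖ ^ 2)) ≤ A := by
    rw [hA]
    nlinarith [hlow1, h6, mul_nonneg h6 (sq_nonneg p), h8, mul_nonneg h8 (sq_nonneg ‖e‖)]
  have hAabs : |A| ≤ (14 + 56 * c) * ((σ⁻¹) ^ 5 * ‖e‖ ^ 2) := by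
    have hX : 0 ≤ (σ⁻¹) ^ 5 * ‖e‖ ^ 2 := by positivity
    rw [abs_le]; constructor <;> nlinarith [hAup, hAlow, hX, hc0]
  rw [hFA, abs_mul, abs_of_nonneg (by positivity : (0 : ℝ) ≤ 2 * p)]
  calc 2 * p * |A| ≤ 2 * p * ((14 + 56 * c) * ((σ⁻¹) ^ 5 * ‖e‖ ^ 2)) :=
        mul_le_mul_of_nonneg_left hAabs (by positivity)
    _ = (14 + 56 * c) * ‖e‖ ^ 2 * (2 * p * (σ⁻¹) ^ 5) := by ring

/-- The telescoping majorant `Ψ(t) = −(C‖e‖²/4)·(‖v+te‖²)⁻⁴` has derivative `C‖e‖²·2⟪v+te,e⟫(‖v+te‖²)⁻⁵`. [folklore] -/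
theorem h1_line_hasDerivAt_majorant (C : ℝ) {t : ℝ} (hq : ‖v + t • e‖ ^ 2 ≠ 0) :
    HasDerivAt (fun t : ℝ => -(C * ‖e‖ ^ 2 / 4) * ((‖v + t • e‖ ^ 2)⁻¹) ^ 4)
      (C * ‖e‖ ^ 2 * (2 * inner ℝ (v + t • e) e * ((‖v + t • e‖ ^ 2)⁻¹) ^ 5)) t := by
  have hq' : HasDerivAt (fun t : ℝ => ‖v + t • e‖ ^ 2) (2 * inner ℝ v e + 2 * t * ‖e‖ ^ 2) t :=
    h1_line_hasDerivAt_norm_sq v e t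
  have hinv : HasDerivAt (fun s : ℝ => s⁻¹) (-((‖v + t • e‖ ^ 2) ^ 2)⁻¹) (‖v + t • e‖ ^ 2) := hasDerivAt_inv hq
  have h4 : HasDerivAt (fun y : ℝ => y⁻¹ ^ 4) (((4 : ℕ) : ℝ) * (‖v + t • e‖ ^ 2)⁻¹ ^ (4 - 1) * -((‖v + t • e‖ ^ 2) ^ 2)⁻¹)
      (‖v + t • e‖ ^ 2) := hinv.pow 4
  have hcomp := h4.comp t hq'
  have h := hcomp.const_mul (-(C * ‖e‖ ^ 2 / 4))
  refine HasDerivAt.congr_deriv h ?_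
  rw [h1_line_inner]
  push_cast
  field_simp

/-- `∫_{c}^{c+½} (s − c) ds = 1/8` and `∫_{c−½}^{c} (c − s) ds = 1/8`. [folklore] -/
theorem h1_integral_half (c : ℝ) :
    (∫ s in c..(c + 1 / 2), (s - c)) = 1 / 8 ∧ (∫ s in (c - 1 / 2)..c, (c - s)) = 1 / 8 := by
  constructor
  · rw [intervalIntegral.integral_comp_sub_right (fun x : ℝ => x) c, integral_id]
    norm_num
  · have e1 : (fun s : ℝ => c - s) = fun s : ℝ => -(s - c) := funext fun s => by ring
    rw [e1, intervalIntegral.integral_neg, intervalIntegral.integral_comp_sub_right (fun x : ℝ => x) c, integral_id]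
    norm_num

/-- **The sharp trapezoid step.**  On an outgoing line (`v ≠ 0`, `⟪v,e⟫ ≥ 0`), for `k ≥ 0`, with `Φ(t) = ½W(‖v+te‖²)`, `F = Φ′`,
`Ψ(t) = −(C‖e‖²/4)(‖v+te‖²)⁻⁴`, `C = 14 + 56‖v‖⁻⁶`:
`|F(k+1) − (Φ(k+1) − Φ(k)) − ½(F(k+1) − F(k))| ≤ (1/8)·(Ψ(k+1) − Ψ(k))`
(`∫_k^{k+1}(s−k−½)F′ = ½F(k+1) + ½F(k) − ∫F`; `F′ ± Ψ` are monotone/antitone since `|F″| ≤ Ψ′`, so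
`|F′(s) − F′(k+½)| ≤ |Ψ(s) − Ψ(k+½)|`; split at `k+½` with `∫₀^{½} x dx = 1/8`). [folklore] -/
theorem h1_tail_step_sharp (hv : 0 < ‖v‖) (hve : 0 ≤ inner ℝ v e) {k : ℝ} (hk : 0 ≤ k) :
    |ljSqDeriv (‖v + (k + 1) • e‖ ^ 2) * inner ℝ (v + (k + 1) • e) e -
          (1 / 2 * (1 / 12 * ((‖v + (k + 1) • e‖ ^ 2)⁻¹) ^ 6 - 1 / 6 * ((‖v + (k + 1) • e‖ ^ 2)⁻¹) ^ 3) -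
            1 / 2 * (1 / 12 * ((‖v + k • e‖ ^ 2)⁻¹) ^ 6 - 1 / 6 * ((‖v + k • e‖ ^ 2)⁻¹) ^ 3)) -
        1 / 2 * (ljSqDeriv (‖v + (k + 1) • e‖ ^ 2) * inner ℝ (v + (k + 1) • e) e -
          ljSqDeriv (‖v + k • e‖ ^ 2) * inner ℝ (v + k • e) e)| ≤
      1 / 8 * (-((14 + 56 * (‖v‖⁻¹) ^ 6) * ‖e‖ ^ 2 / 4) * ((‖v + (k + 1) • e‖ ^ 2)⁻¹) ^ 4 -
        -((14 + 56 * (‖v‖⁻¹) ^ 6) * ‖e‖ ^ 2 / 4) * ((‖v + k • e‖ ^ 2)⁻¹) ^ 4) := by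
  -- names
  set C : ℝ := 14 + 56 * (‖v‖⁻¹) ^ 6 with hC
  set Φ : ℝ → ℝ := fun t => 1 / 2 * (1 / 12 * ((‖v + t • e‖ ^ 2)⁻¹) ^ 6 - 1 / 6 * ((‖v + t • e‖ ^ 2)⁻¹) ^ 3) with hΦ
  set F : ℝ → ℝ := fun t => ljSqDeriv (‖v + t • e‖ ^ 2) * inner ℝ (v + t • e) e with hF
  set F₁ : ℝ → ℝ := fun t => (7 / 2 * ((‖v + t • e‖ ^ 2)⁻¹) ^ 8 - 2 * ((‖v + t • e‖ ^ 2)⁻¹) ^ 5) *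
      (2 * inner ℝ (v + t • e) e ^ 2) + ljSqDeriv (‖v + t • e‖ ^ 2) * ‖e‖ ^ 2 with hF₁
  set F₂ : ℝ → ℝ := fun t => (10 * ((‖v + t • e‖ ^ 2)⁻¹) ^ 6 - 28 * ((‖v + t • e‖ ^ 2)⁻¹) ^ 9) *
      (4 * inner ℝ (v + t • e) e ^ 3) + (7 / 2 * ((‖v + t • e‖ ^ 2)⁻¹) ^ 8 - 2 * ((‖v + t • e‖ ^ 2)⁻¹) ^ 5) *
        (6 * inner ℝ (v + t • e) e * ‖e‖ ^ 2) with hF₂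
  set Ψ : ℝ → ℝ := fun t => -(C * ‖e‖ ^ 2 / 4) * ((‖v + t • e‖ ^ 2)⁻¹) ^ 4 with hΨ
  set Ψ₁ : ℝ → ℝ := fun t => C * ‖e‖ ^ 2 * (2 * inner ℝ (v + t • e) e * ((‖v + t • e‖ ^ 2)⁻¹) ^ 5) with hΨ₁
  have hv2 : 0 < ‖v‖ ^ 2 := by positivity
  have hqpos : ∀ t : ℝ, 0 ≤ t → 0 < ‖v + t • e‖ ^ 2 := fun t ht =>
    lt_of_lt_of_le hv2 (le_trans (by nlinarith) (h1_line_norm_sq_ge hve ht).1)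
  have hdΦ : ∀ t : ℝ, 0 ≤ t → HasDerivAt Φ (F t) t := fun t ht => h1_line_hasDerivAt_prim (hqpos t ht).ne'
  have hdF : ∀ t : ℝ, 0 ≤ t → HasDerivAt F (F₁ t) t := fun t ht => h1_line_hasDerivAt_load (hqpos t ht).ne'
  have hdF₁ : ∀ t : ℝ, 0 ≤ t → HasDerivAt F₁ (F₂ t) t := fun t ht => h1_line_hasDerivAt_load2 (hqpos t ht).ne'
  have hdΨ : ∀ t : ℝ, 0 ≤ t → HasDerivAt Ψ (Ψ₁ t) t := fun t ht => h1_line_hasDerivAt_majorant C (hqpos t ht).ne'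
  have hF₂le : ∀ t : ℝ, 0 ≤ t → |F₂ t| ≤ Ψ₁ t := fun t ht => h1_line_load2_le_majorant hv hve ht
  have hkk : k ≤ k + 1 := by linarith
  have hI : Set.uIcc k (k + 1) = Set.Icc k (k + 1) := Set.uIcc_of_le hkk
  have hmem : ∀ t ∈ Set.uIcc k (k + 1), 0 ≤ t := fun t ht => by rw [hI] at ht; exact hk.trans ht.1
  -- continuity ⇒ integrability
  have hFc : ContinuousOn F (Set.uIcc k (k + 1)) := fun t ht =>
    (hdF t (hmem t ht)).continuousAt.continuousWithinAt
  have hF₁c : ContinuousOn F₁ (Set.uIcc k (k + 1)) := fun t ht =>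
    (hdF₁ t (hmem t ht)).continuousAt.continuousWithinAt
  have hFi : IntervalIntegrable F MeasureTheory.volume k (k + 1) := hFc.intervalIntegrable
  have hF₁i : IntervalIntegrable F₁ MeasureTheory.volume k (k + 1) := hF₁c.intervalIntegrable
  -- FTC for `Φ`
  have hFTC : ∫ s in k..(k + 1), F s = Φ (k + 1) - Φ k :=
    intervalIntegral.integral_eq_sub_of_hasDerivAt (fun t ht => hdΦ t (hmem t ht)) hFi
  -- integration by parts against `u(s) = s − (k + ½)`
  set c : ℝ := k + 1 / 2 with hc
  set u : ℝ → ℝ := fun s => s - c with hu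
  have huc : Continuous u := continuous_id.sub continuous_const
  have hdu : ∀ s : ℝ, HasDerivAt u ((fun _ : ℝ => (1 : ℝ)) s) s := fun s => by
    show HasDerivAt (fun s : ℝ => s - c) 1 s
    exact (hasDerivAt_id' s).sub_const c
  have h1i : IntervalIntegrable (fun _ : ℝ => (1 : ℝ)) MeasureTheory.volume k (k + 1) := intervalIntegrable_const
  have hparts : ∫ s in k..(k + 1), u s * F₁ s =
      u (k + 1) * F (k + 1) - u k * F k - ∫ s in k..(k + 1), (fun _ : ℝ => (1 : ℝ)) s * F s :=
    intervalIntegral.integral_mul_deriv_eq_deriv_mul (fun s _ => hdu s) (fun t ht => hdF t (hmem t ht)) h1i hF₁i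
  have hIval : ∫ s in k..(k + 1), u s * F₁ s = 1 / 2 * F (k + 1) + 1 / 2 * F k - (Φ (k + 1) - Φ k) := by
    rw [hparts]
    simp only [one_mul]
    rw [hFTC, hu, hc]
    ring
  -- the centred form
  set c₁ : ℝ := F₁ c with hc₁
  have hGc : ContinuousOn (fun s => u s * (F₁ s - c₁)) (Set.uIcc k (k + 1)) :=
    huc.continuousOn.mul (hF₁c.sub continuousOn_const)
  have hUi : IntervalIntegrable (fun s => u s * c₁) MeasureTheory.volume k (k + 1) :=
    (huc.continuousOn.mul continuousOn_const).intervalIntegrable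
  have hcent : ∫ s in k..(k + 1), u s * F₁ s = ∫ s in k..(k + 1), u s * (F₁ s - c₁) := by
    have h1 : (∫ s in k..(k + 1), u s * (F₁ s - c₁)) + ∫ s in k..(k + 1), u s * c₁ =
        ∫ s in k..(k + 1), u s * F₁ s := by
      rw [← intervalIntegral.integral_add hGc.intervalIntegrable hUi]
      congr 1; funext s; ring
    have h2 : ∫ s in k..(k + 1), u s * c₁ = 0 := by
      rw [intervalIntegral.integral_mul_const, hu, hc]
      show (∫ s in k..(k + 1), (s - (k + 1 / 2))) * c₁ = 0
      rw [h1_integral_centered k, zero_mul]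
    linarith
  -- monotone comparison: `F₁ + Ψ` increasing, `F₁ − Ψ` decreasing on `[k, k+1]`
  have hcIcc : c ∈ Set.Icc k (k + 1) := ⟨by rw [hc]; linarith, by rw [hc]; linarith⟩
  have hint : interior (Set.Icc k (k + 1)) = Set.Ioo k (k + 1) := interior_Icc
  have hmono : MonotoneOn (fun t => F₁ t + Ψ t) (Set.Icc k (k + 1)) := by
    refine monotoneOn_of_hasDerivWithinAt_nonneg (f' := fun t => F₂ t + Ψ₁ t) (convex_Icc k (k + 1))
      (fun t ht => ((hdF₁ t (hk.trans ht.1)).add (hdΨ t (hk.trans ht.1))).continuousAt.continuousWithinAt)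
      (fun t ht => ?_) (fun t ht => ?_)
    · rw [hint] at ht
      exact ((hdF₁ t (hk.trans ht.1.le)).add (hdΨ t (hk.trans ht.1.le))).hasDerivWithinAt
    · rw [hint] at ht
      have := hF₂le t (hk.trans ht.1.le)
      have := neg_abs_le (F₂ t)
      linarith
  have hanti : AntitoneOn (fun t => F₁ t - Ψ t) (Set.Icc k (k + 1)) := by
    refine antitoneOn_of_hasDerivWithinAt_nonpos (f' := fun t => F₂ t - Ψ₁ t) (convex_Icc k (k + 1))
      (fun t ht => ((hdF₁ t (hk.trans ht.1)).sub (hdΨ t (hk.trans ht.1))).continuousAt.continuousWithinAt)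
      (fun t ht => ?_) (fun t ht => ?_)
    · rw [hint] at ht
      exact ((hdF₁ t (hk.trans ht.1.le)).sub (hdΨ t (hk.trans ht.1.le))).hasDerivWithinAt
    · rw [hint] at ht
      have := hF₂le t (hk.trans ht.1.le)
      have := le_abs_self (F₂ t)
      linarith
  -- pointwise: `|u(s)(F₁ s − F₁ c)| ≤ u(s)(Ψ s − Ψ c)` on `[k, k+1]`
  have hpw : ∀ s ∈ Set.Icc k (k + 1), |u s * (F₁ s - c₁)| ≤ u s * (Ψ s - Ψ c) := by
    intro s hs
    rcases le_total c s with hcs | hsc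
    · -- s ≥ c
      have h1 := hmono hcIcc hs hcs
      have h2 := hanti hcIcc hs hcs
      simp only at h1 h2
      have hu0 : 0 ≤ u s := by show 0 ≤ s - c; linarith
      rw [abs_mul, abs_of_nonneg hu0]
      refine mul_le_mul_of_nonneg_left ?_ hu0
      rw [hc₁, abs_le]; constructor <;> linarith
    · -- s ≤ c
      have h1 := hmono hs hcIcc hsc
      have h2 := hanti hs hcIcc hsc
      simp only at h1 h2
      have hu0 : u s ≤ 0 := by show s - c ≤ 0; linarith
      rw [abs_mul, abs_of_nonpos hu0]
      have : |F₁ s - c₁| ≤ Ψ c - Ψ s := by rw [hc₁, abs_le]; constructor <;> linarith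
      nlinarith [this, abs_nonneg (F₁ s - c₁)]
  -- split at `c` and bound each half by a linear majorant
  have hkc : k ≤ c := by rw [hc]; linarith
  have hck : c ≤ k + 1 := by rw [hc]; linarith
  have hGi1 : IntervalIntegrable (fun s => u s * (F₁ s - c₁)) MeasureTheory.volume k c :=
    (hGc.mono (by rw [hI]; exact Set.uIcc_subset_Icc ⟨le_rfl, hkk⟩ hcIcc)).intervalIntegrable
  have hGi2 : IntervalIntegrable (fun s => u s * (F₁ s - c₁)) MeasureTheory.volume c (k + 1) :=
    (hGc.mono (by rw [hI]; exact Set.uIcc_subset_Icc hcIcc ⟨hkk, le_rfl⟩)).intervalIntegrable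
  have hsplit : ∫ s in k..(k + 1), u s * (F₁ s - c₁) =
      (∫ s in k..c, u s * (F₁ s - c₁)) + ∫ s in c..(k + 1), u s * (F₁ s - c₁) :=
    (intervalIntegral.integral_add_adjacent_intervals hGi1 hGi2).symm
  have hΨmono : MonotoneOn Ψ (Set.Icc k (k + 1)) := by
    intro x hx y hy hxy
    have h1 := hmono hx hy hxy
    have h2 := hanti hx hy hxy
    simp only at h1 h2
    linarith
  -- right half
  have hR : |∫ s in c..(k + 1), u s * (F₁ s - c₁)| ≤ 1 / 8 * (Ψ (k + 1) - Ψ c) := by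
    have hD : 0 ≤ Ψ (k + 1) - Ψ c := by linarith [hΨmono hcIcc ⟨hkk, le_rfl⟩ hck]
    have hpt : ∀ᵐ s ∂MeasureTheory.volume, s ∈ Set.Ioc c (k + 1) →
        ‖u s * (F₁ s - c₁)‖ ≤ (Ψ (k + 1) - Ψ c) * (s - c) := by
      refine Filter.Eventually.of_forall fun s hs => ?_
      have hs' : s ∈ Set.Icc k (k + 1) := ⟨hkc.trans hs.1.le, hs.2⟩
      rw [Real.norm_eq_abs]
      refine (hpw s hs').trans ?_
      have hu0 : 0 ≤ u s := by show 0 ≤ s - c; linarith [hs.1]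
      have hΨs : Ψ s - Ψ c ≤ Ψ (k + 1) - Ψ c := by linarith [hΨmono hs' ⟨hkk, le_rfl⟩ hs.2]
      calc u s * (Ψ s - Ψ c) ≤ u s * (Ψ (k + 1) - Ψ c) := mul_le_mul_of_nonneg_left hΨs hu0
        _ = (Ψ (k + 1) - Ψ c) * (s - c) := by rw [hu]; ring
    have hgi : IntervalIntegrable (fun s : ℝ => (Ψ (k + 1) - Ψ c) * (s - c)) MeasureTheory.volume c (k + 1) :=
      (continuous_const.mul (continuous_id.sub continuous_const)).intervalIntegrable _ _
    have h := intervalIntegral.norm_integral_le_of_norm_le hck hpt hgi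
    rw [Real.norm_eq_abs, intervalIntegral.integral_const_mul] at h
    have e1 : ∫ s in c..(k + 1), (s - c) = 1 / 8 := by
      have := (h1_integral_half c).1; rwa [show c + 1 / 2 = k + 1 by rw [hc]; ring] at this
    rw [e1] at h
    linarith
  -- left half
  have hL : |∫ s in k..c, u s * (F₁ s - c₁)| ≤ 1 / 8 * (Ψ c - Ψ k) := by
    have hD : 0 ≤ Ψ c - Ψ k := by linarith [hΨmono ⟨le_rfl, hkk⟩ hcIcc hkc]
    have hpt : ∀ᵐ s ∂MeasureTheory.volume, s ∈ Set.Ioc k c →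
        ‖u s * (F₁ s - c₁)‖ ≤ (Ψ c - Ψ k) * (c - s) := by
      refine Filter.Eventually.of_forall fun s hs => ?_
      have hs' : s ∈ Set.Icc k (k + 1) := ⟨hs.1.le, hs.2.trans hck⟩
      rw [Real.norm_eq_abs]
      refine (hpw s hs').trans ?_
      have hu0 : 0 ≤ -u s := by show 0 ≤ -(s - c); linarith [hs.2]
      have hΨs : Ψ c - Ψ s ≤ Ψ c - Ψ k := by linarith [hΨmono ⟨le_rfl, hkk⟩ hs' hs.1.le]
      calc u s * (Ψ s - Ψ c) = (-u s) * (Ψ c - Ψ s) := by ring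
        _ ≤ (-u s) * (Ψ c - Ψ k) := mul_le_mul_of_nonneg_left hΨs hu0
        _ = (Ψ c - Ψ k) * (c - s) := by rw [hu]; ring
    have hgi : IntervalIntegrable (fun s : ℝ => (Ψ c - Ψ k) * (c - s)) MeasureTheory.volume k c :=
      (continuous_const.mul (continuous_const.sub continuous_id)).intervalIntegrable _ _
    have h := intervalIntegral.norm_integral_le_of_norm_le hkc hpt hgi
    rw [Real.norm_eq_abs, intervalIntegral.integral_const_mul] at h
    have e1 : ∫ s in k..c, (c - s) = 1 / 8 := by
      have := (h1_integral_half c).2; rwa [show c - 1 / 2 = k by rw [hc]; ring] at this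
    rw [e1] at h
    linarith
  -- assemble
  have key : F (k + 1) - (Φ (k + 1) - Φ k) - 1 / 2 * (F (k + 1) - F k) = ∫ s in k..(k + 1), u s * (F₁ s - c₁) := by
    rw [← hcent, hIval]; ring
  show |F (k + 1) - (Φ (k + 1) - Φ k) - 1 / 2 * (F (k + 1) - F k)| ≤ 1 / 8 * (Ψ (k + 1) - Ψ k)
  rw [key, hsplit]
  calc |(∫ s in k..c, u s * (F₁ s - c₁)) + ∫ s in c..(k + 1), u s * (F₁ s - c₁)|
      ≤ |∫ s in k..c, u s * (F₁ s - c₁)| + |∫ s in c..(k + 1), u s * (F₁ s - c₁)| := abs_add_le _ _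
    _ ≤ 1 / 8 * (Ψ c - Ψ k) + 1 / 8 * (Ψ (k + 1) - Ψ c) := add_le_add hL hR
    _ = 1 / 8 * (Ψ (k + 1) - Ψ k) := by ring

end Line3

end Summit.AtomisticToContinuum.Crystallization.Theorems.StrictSplittingRuleBirth

end
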